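import Summits.HodgeConjecture.CorCM.MultiFieldWeilAtMostTwoThreefoldsTwoSurfacesAnyCurves
import Summits.HodgeConjecture.CorCM.CMAbelianFourfoldPowers
import HarnessLib

/-!
# MULTI-FIELD WEIL ENGINE — ON THE VARIETY: a complex abelian variety of CM type whose simple isogeny factors have dimension `≤ 3`, with at most TWO isogeny classes
# of THREEFOLD factors and at most TWO isogeny classes of SURFACE factors (any elliptic ones), satisfies the Hodge conjecture together with everything dominated by its
# powers — given ONLY Markman's fourfold theorem

Cell `pub-hodgecm2` (COR-CM), seat b30 gen 35 (2026-08-25); count-neutral own lane MULTI-FIELD WEIL ENGINE (stem `MultiFieldWeil*`) — the INTRINSIC form of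
`CorCM/MultiFieldWeilAtMostTwoThreefoldsTwoSurfacesAnyCurves.lean`, read on the variety through Milne's regrouping (`exists_isIsogeny_biproduct_of_isSimple_of_isOfCMType`,
seat b16), in the shape of gen 34's `CorCM/MultiFieldWeilAtMostTwoNonCurveFactors.lean`, which it SUPERSEDES («at most two non-elliptic classes» ⟹ «at most two threefold
classes and at most two surface classes»; the gate's dedup lint forbids restating that file's signature here, so the implication is left to the reader: (b), (c) below are
its hypothesis restricted to dimension `3`, resp. `2`).  Theorems only; no definition, no named fact, no `sorry`.  HONEST FRAMING: conditional on the displayed Markman fourfold binder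
only; `HC_CM` is NOT proved and not asserted — this is a statement about a NAMED CLASS of CM abelian varieties.

THE STATEMENT (**`hodgeConjectureFor_of_avDominatedBy_powSucc_of_isOfCMType_of_atMostTwo_threefold_surface_classes_of_markman`**).  Let `X` be a complex abelian variety
of CM type (`Milne1999.IsOfCMType X`) such that (a) every SIMPLE isogeny factor of `X` has dimension `≤ 3`; (b) among any THREE simple isogeny factors of dimension `3`
two are isogenous; (c) among any THREE simple isogeny factors of dimension `2` two are isogenous.  Then EVERY complex abelian variety dominated by a power `X^{N+1}` — every
power of `X`, everything isogenous to one, every abelian subvariety or quotient of one — satisfies the Hodge conjecture, GIVEN ONLY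
`Markman2025_weilClasses_algebraic_abelianFourfold`.  In words: **up to isogeny `X = E₁^{n₁} × ⋯ × E_r^{n_r} × S₀^{a} × S₁^{b} × T₀^{c} × T₁^{d}` with ANY CM elliptic
curves `E_e`, at most two simple CM surfaces and at most two simple CM threefolds — nothing assumed on any of the CM fields.**  Seat b16's dihedral surface triple
(obstruction (iii′) of `CorCM/CMAbelianFactorsDimLeThreeClassification.lean`) shows that (c) cannot be dropped without a new input; (b) is where this lane's census of three
simple threefolds (cubic towers, `C₃ × C₃` composita) takes over.

PROOF.  Milne's regrouping `X ∼ ⨁_i A'_{cls i}` (`A'_c` simple, pairwise NON-isogenous, CM-realised over ONE index type); (a) bounds the dimensions, (b) and (c) become «among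
any three sextic (quartic) slots two coincide» (`[K'_c : ℚ] = 2 dim A'_c`); every power of `X` is dominated by a product of copies of the slots
(`exists_avDominatedBy_powSucc_biproduct_slots`), and the previous file's dominated form applies verbatim — no re-indexing needed.

[cite: MoonenZarhin1999LowDim, Thm. (0.1), Thm. (0.2), §3 (3.1), Cor. (3.9), §5 (5.2)] [cite: Markman2025SurveySecant, Thm. 1.2] [cite: Milne1999LefschetzClasses, §1 Prop. 1.1]
[cite: MumfordAV1970, §19 Thm. 1, Cor. 1–2 and p. 169] [cite: Gordon1999HodgeAVSurvey, §3 Theorem (proof), 7.4–7.7, 10.10]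

## References
* [MoonenZarhin1999LowDim] B. Moonen, Yu. Zarhin, Math. Ann. 315 (1999) 711–733.  [Markman2025SurveySecant] E. Markman, arXiv:2509.23403, Thm. 1.2.
  [Milne1999LefschetzClasses] J. S. Milne, *Lefschetz classes on abelian varieties*, Duke Math. J. 96 (1999), §1 Prop. 1.1.  [MumfordAV1970] D. Mumford, *Abelian
  Varieties*, §19.  [Gordon1999HodgeAVSurvey] B. B. Gordon, *A survey of the Hodge conjecture for abelian varieties*, §3, 7.4–7.7, 10.10.
-/

noncomputable section

open CategoryTheory CategoryTheory.Limits NumberField IntermediateField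

namespace Summit.HodgeConjecture.CorCM.MultiFieldWeil

open Literature.AlgebraicGeometry Literature.AlgebraicGeometry.Motives Literature.AlgebraicGeometry.HodgeTheory
open Literature.AlgebraicGeometry.Motives.AbelianVariety
open Literature.AlgebraicGeometry.ComplexMultiplication (IsCMTypeRealisation)
open Literature.AlgebraicTopology.SingularHomology
open Literature.NumberTheory.ComplexMultiplication
open Literature.AlgebraicGeometry.Milne1999 (IsOfCMType)
open Summit.HodgeConjecture.CorCM.Domination

open scoped Classical

section OnTheVariety

variable {X : AbelianVariety ℂ}

/-- Powers of a zero-dimensional abelian variety are zero-dimensional. [folklore] -/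
private theorem dim_powSucc_eq_zero₃₅ (h0 : X.dim = 0) : ∀ N : ℕ, (X.powSucc N).dim = 0
  | 0 => h0
  | N + 1 => by rw [powSucc_succ, dim_prod, dim_powSucc_eq_zero₃₅ h0 N, h0]

/-- **MAIN THEOREM (on the variety) — AT MOST TWO THREEFOLD CLASSES, AT MOST TWO SURFACE CLASSES, ANY ELLIPTIC FACTORS, ALL SIMPLE FACTORS OF DIMENSION `≤ 3`, given ONLY
Markman's fourfold theorem.**  `X` a complex abelian variety of CM type; (a) every simple isogeny factor of `X` has dimension `≤ 3`; (b) among any three simple isogeny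
factors of dimension `3`, two are isogenous; (c) among any three simple isogeny factors of dimension `2`, two are isogenous.  Then every complex abelian variety dominated by
a power `X^{N+1}` satisfies the Hodge conjecture, GIVEN ONLY `Markman2025_weilClasses_algebraic_abelianFourfold` (Milne's regrouping into simple pairwise non-isogenous
CM-realised factors, then `hodgeConjectureFor_of_avDominatedBy_prod_of_atMostTwo_threefolds_atMostTwo_surfaces_of_markman`).  `HC_CM` is NOT asserted.
[cite: Milne1999LefschetzClasses, §1 Prop. 1.1] [cite: MoonenZarhin1999LowDim, Thm. (0.1), (0.2), §3 (3.1), Cor. (3.9)] [cite: Markman2025SurveySecant, Thm. 1.2]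
[cite: MumfordAV1970, §19 Thm. 1, Cor. 1–2] -/
theorem hodgeConjectureFor_of_avDominatedBy_powSucc_of_isOfCMType_of_atMostTwo_threefold_surface_classes_of_markman
    (hW4 : Markman2025_weilClasses_algebraic_abelianFourfold) (hcm : IsOfCMType X)
    (h3 : ∀ B : AbelianVariety ℂ, B.IsSimple → AVDominatedBy B X → B.dim ≤ 3)
    (hT : ∀ B₀ B₁ B₂ : AbelianVariety ℂ, B₀.IsSimple → B₁.IsSimple → B₂.IsSimple → AVDominatedBy B₀ X → AVDominatedBy B₁ X → AVDominatedBy B₂ X →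
      B₀.dim = 3 → B₁.dim = 3 → B₂.dim = 3 → IsIsogenous B₀ B₁ ∨ IsIsogenous B₀ B₂ ∨ IsIsogenous B₁ B₂)
    (hS : ∀ B₀ B₁ B₂ : AbelianVariety ℂ, B₀.IsSimple → B₁.IsSimple → B₂.IsSimple → AVDominatedBy B₀ X → AVDominatedBy B₁ X → AVDominatedBy B₂ X →
      B₀.dim = 2 → B₁.dim = 2 → B₂.dim = 2 → IsIsogenous B₀ B₁ ∨ IsIsogenous B₀ B₂ ∨ IsIsogenous B₁ B₂)
    {B : AbelianVariety ℂ} {N : ℕ} (hB : AVDominatedBy B (X.powSucc N)) : HodgeConjectureFor B.dim B.X := by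
  rcases Nat.eq_zero_or_pos X.dim with h0 | hX0
  · exact hodgeConjectureFor_of_isDivisorGenerated _ (isDivisorGenerated_of_avDominatedBy hB
      (Literature.AlgebraicGeometry.Pohlmann1968.isDivisorGenerated_of_dim_eq_zero _ (dim_powSucc_eq_zero₃₅ h0 N)))
  -- Milne's regrouping: `X ∼ ⨁_i A'_{cls i}`, `A'_c` simple, pairwise non-isogenous, CM-realised
  obtain ⟨C, _, K', _, _, _, Φ', A', ι', θ', m, cls, f, hA, hs, hniso, hcls, hf⟩ := exists_isIsogeny_biproduct_of_isSimple_of_isOfCMType (X := X) hX0 hcm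
  have hXP : AVDominatedBy X (⨁ fun i => A' (cls i)) := AVDominatedBy.of_isIsogeny_hom hf (AVDominatedBy.refl _)
  have hPX : AVDominatedBy (⨁ fun i => A' (cls i)) X := AVDominatedBy.of_isIsogeny_inv hf (AVDominatedBy.refl _)
  have hslot : ∀ c, AVDominatedBy (A' c) X := fun c => by
    obtain ⟨i, rfl⟩ := hcls c
    exact (avDominatedBy_biproduct_summand (fun i => A' (cls i)) i).trans hPX
  have hdim3 : ∀ c, (A' c).dim ≤ 3 := fun c => h3 _ (hs c) (hslot c)
  have hfin : ∀ c, Module.finrank ℚ (K' c) = 2 * (A' c).dim := fun c =>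
    Literature.AlgebraicGeometry.Pohlmann1968.finrank_eq_two_mul_dim_of_isCMTypeRealisation (hA c)
  -- isogenous slots coincide
  have heq : ∀ c c', IsIsogenous (A' c) (A' c') → c = c' := fun c c' h => by
    by_contra hne
    exact hniso c c' hne h
  -- (b), (c) on the slots
  have hT2 : ∀ c c' c'' : C, Module.finrank ℚ (K' c) = 6 → Module.finrank ℚ (K' c') = 6 → Module.finrank ℚ (K' c'') = 6 → c = c' ∨ c = c'' ∨ c' = c'' := by
    intro c c' c'' h h' h''
    rcases hT (A' c) (A' c') (A' c'') (hs c) (hs c') (hs c'') (hslot c) (hslot c') (hslot c'') (by have := hfin c; omega) (by have := hfin c'; omega)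
        (by have := hfin c''; omega) with hi | hi | hi
    · exact Or.inl (heq _ _ hi)
    · exact Or.inr (Or.inl (heq _ _ hi))
    · exact Or.inr (Or.inr (heq _ _ hi))
  have hS2 : ∀ c c' c'' : C, Module.finrank ℚ (K' c) = 4 → Module.finrank ℚ (K' c') = 4 → Module.finrank ℚ (K' c'') = 4 → c = c' ∨ c = c'' ∨ c' = c'' := by
    intro c c' c'' h h' h''
    rcases hS (A' c) (A' c') (A' c'') (hs c) (hs c') (hs c'') (hslot c) (hslot c') (hslot c'') (by have := hfin c; omega) (by have := hfin c'; omega)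
        (by have := hfin c''; omega) with hi | hi | hi
    · exact Or.inl (heq _ _ hi)
    · exact Or.inr (Or.inl (heq _ _ hi))
    · exact Or.inr (Or.inr (heq _ _ hi))
  -- every power of `X` is dominated by a product of copies of the slots
  obtain ⟨n, π, hdom⟩ := exists_avDominatedBy_powSucc_biproduct_slots A' cls hXP N
  exact hodgeConjectureFor_of_avDominatedBy_prod_of_atMostTwo_threefolds_atMostTwo_surfaces_of_markman hW4 hA hs hdim3 hT2 hS2 π (hB.trans hdom)

/-- **In particular the Hodge conjecture for `X` itself** (and for all its powers): a complex abelian variety of CM type with simple isogeny factors of dimension `≤ 3`, at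
most two isogeny classes of threefold factors and at most two of surface factors, given only Markman's fourfold theorem. [cite: MoonenZarhin1999LowDim, Thm. (0.1), (0.2)]
[cite: Markman2025SurveySecant, Thm. 1.2] -/
theorem hodgeConjectureFor_powSucc_of_isOfCMType_of_atMostTwo_threefold_surface_classes_of_markman (hW4 : Markman2025_weilClasses_algebraic_abelianFourfold)
    (hcm : IsOfCMType X) (h3 : ∀ B : AbelianVariety ℂ, B.IsSimple → AVDominatedBy B X → B.dim ≤ 3)
    (hT : ∀ B₀ B₁ B₂ : AbelianVariety ℂ, B₀.IsSimple → B₁.IsSimple → B₂.IsSimple → AVDominatedBy B₀ X → AVDominatedBy B₁ X → AVDominatedBy B₂ X →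
      B₀.dim = 3 → B₁.dim = 3 → B₂.dim = 3 → IsIsogenous B₀ B₁ ∨ IsIsogenous B₀ B₂ ∨ IsIsogenous B₁ B₂)
    (hS : ∀ B₀ B₁ B₂ : AbelianVariety ℂ, B₀.IsSimple → B₁.IsSimple → B₂.IsSimple → AVDominatedBy B₀ X → AVDominatedBy B₁ X → AVDominatedBy B₂ X →
      B₀.dim = 2 → B₁.dim = 2 → B₂.dim = 2 → IsIsogenous B₀ B₁ ∨ IsIsogenous B₀ B₂ ∨ IsIsogenous B₁ B₂)
    (N : ℕ) : HodgeConjectureFor (X.powSucc N).dim (X.powSucc N).X :=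
  hodgeConjectureFor_of_avDominatedBy_powSucc_of_isOfCMType_of_atMostTwo_threefold_surface_classes_of_markman hW4 hcm h3 hT hS (AVDominatedBy.refl _)

/-- **The Hodge conjecture for `X` itself.** [cite: MoonenZarhin1999LowDim, Thm. (0.1), (0.2)] [cite: Markman2025SurveySecant, Thm. 1.2] -/
theorem hodgeConjectureFor_of_isOfCMType_of_atMostTwo_threefold_surface_classes_of_markman (hW4 : Markman2025_weilClasses_algebraic_abelianFourfold)
    (hcm : IsOfCMType X) (h3 : ∀ B : AbelianVariety ℂ, B.IsSimple → AVDominatedBy B X → B.dim ≤ 3)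
    (hT : ∀ B₀ B₁ B₂ : AbelianVariety ℂ, B₀.IsSimple → B₁.IsSimple → B₂.IsSimple → AVDominatedBy B₀ X → AVDominatedBy B₁ X → AVDominatedBy B₂ X →
      B₀.dim = 3 → B₁.dim = 3 → B₂.dim = 3 → IsIsogenous B₀ B₁ ∨ IsIsogenous B₀ B₂ ∨ IsIsogenous B₁ B₂)
    (hS : ∀ B₀ B₁ B₂ : AbelianVariety ℂ, B₀.IsSimple → B₁.IsSimple → B₂.IsSimple → AVDominatedBy B₀ X → AVDominatedBy B₁ X → AVDominatedBy B₂ X →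
      B₀.dim = 2 → B₁.dim = 2 → B₂.dim = 2 → IsIsogenous B₀ B₁ ∨ IsIsogenous B₀ B₂ ∨ IsIsogenous B₁ B₂) :
    HodgeConjectureFor X.dim X.X :=
  hodgeConjectureFor_powSucc_of_isOfCMType_of_atMostTwo_threefold_surface_classes_of_markman hW4 hcm h3 hT hS 0

end OnTheVariety

end Summit.HodgeConjecture.CorCM.MultiFieldWeil

end
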